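import Literature.Analysis.InnerProduct.RankOneDowndate

/-!
# Finite-rank downdates of a nonnegative symmetric operator: inertia transfer to the
# capacitance form (multi-driver law), multi-driver resolvent shadow, matrix secular equation

Topic `Literature/Analysis/InnerProduct` (companion of `RankOneDowndate`, the case of ONE driver).
Let `A` be a symmetric operator on a real inner product space with nonnegative form, let
`v : ι → E` be finitely many DRIVERS, and consider the downdated form
`q(x) = ⟪A x, x⟫ − ∑ᵢ ⟪vᵢ, x⟫²`, i.e. the operator `Q = A − ∑ᵢ |vᵢ⟩⟨vᵢ|`. With witnesses `A zᵢ = vᵢ`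
(`zᵢ = A⁻¹ vᵢ`) the CAPACITANCE form on coefficient space `ι → ℝ` is
`Cap(c) = ∑ᵢ cᵢ² − ∑ᵢ ∑ⱼ cᵢ cⱼ ⟪vᵢ, zⱼ⟫`, the form of the matrix `I − Vᵀ A⁻¹ V`. Everything below is
the elementary linear algebra of the Schur complement / Haynsworth inertia additivity formula
(E. V. Haynsworth 1968; D. S. Bernstein, *Matrix Mathematics* (2009), Fact 6.5.5:
`In 𝒜 = In A + In(𝒜 ∣ A)` for `𝒜 = [[A, V], [Vᵀ, I]]`, so that when `A > 0`,
`In(A − V Vᵀ) = In(I − Vᵀ A⁻¹ V)`), of the Sherman–Morrison–Woodbury "capacitance matrix", and of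
the block secular equation of rank-`m` modifications of the symmetric eigenproblem (Golub–Van Loan
§8.4.3 / Bunch–Nielsen–Sorensen for `m = 1`; Arbenz–Golub 1988 for general `m`) — recorded
DIMENSION-FREE (no spectral theorem, no finite-dimensionality of `E`, no invertibility: the witnesses
`zᵢ` and the resolvent vectors `yᵢ` are hypotheses) in the forms used downstream:

* `finiteRank_downdate_exists_nonneg` — on every subspace of dimension `> #ι` the downdated form is
  nonnegative at some nonzero vector annihilated by all drivers; hence
  `finiteRank_downdate_negSubspace_finrank_le`: a subspace on which `q < 0` has dimension `≤ #ι`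
  (NEGATIVE INDEX ≤ NUMBER OF DRIVERS). [rank-`m` perturbations move the inertia by at most `m`]
* `finiteRank_downdate_capacitance_le` / `finiteRank_downdate_le_capacitance` — the two comparison
  inequalities `Cap(⟪v·, x⟫) ≤ q(x)` and `q(∑ⱼ cⱼ zⱼ) ≤ Cap(c)` (completing the square with
  `x ∓ ∑ⱼ cⱼ zⱼ`).
* `finiteRank_downdate_negSubspace_iff` — INERTIA TRANSFER (multi-driver secular law): for every
  `k`, `q` is negative definite on some `k`-dimensional subspace of `E` iff `Cap` is negative
  definite on some `k`-dimensional subspace of `ι → ℝ`; i.e. `n₋(A − V Vᵀ) = n₋(I − Vᵀ A⁻¹ V)`,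
  the number of eigenvalues of the capacitance matrix `Vᵀ A⁻¹ V` exceeding `1`. For one driver this
  is `rankOne_downdate_indefinite_iff` (`q` indefinite iff `1 < ⟪v, z⟫`). [Haynsworth]
* `finiteRank_downdate_eigenvector_eq_sum` — MULTI-DRIVER RESOLVENT SHADOW: an eigenvector `u` of
  the downdate with eigenvalue `−ε < 0` (`A u − ∑ᵢ ⟪vᵢ, u⟫ vᵢ = −ε u`) lies in the span of the
  resolvent vectors `yᵢ = (A + ε)⁻¹ vᵢ` (`A yᵢ + ε yᵢ = vᵢ`): `u = ∑ᵢ ⟪vᵢ, u⟫ • yᵢ`.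
* `finiteRank_downdate_secular_system` — the MATRIX SECULAR EQUATION at the negative eigenvalue:
  the moment vector `cᵢ = ⟪vᵢ, u⟫` is a nonzero fixed vector of `M(ε) = (⟪vᵢ, yⱼ⟫)ᵢⱼ = Vᵀ(A + ε)⁻¹V`,
  `cᵢ = ∑ⱼ ⟪vᵢ, yⱼ⟫ cⱼ` (so `det(I − Vᵀ (A + ε)⁻¹ V) = 0`). [Arbenz–Golub; GVL Thm 8.4.3 for m = 1]
* `finiteRank_downdate_sum_sq_inner_le` — graded bound: if the downdate is bounded below by `−ε`
  then every unit eigenvector `A φ = α φ` has `∑ᵢ ⟪vᵢ, φ⟫² ≤ α + ε` (the drivers are jointly almost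
  orthogonal to the eigenvectors of `A` far below the scale `ε`).

Motivation (pub-rhpf cell THEORY-3, gen 4, "multi-driver law"; mechanism/rigidity campaign, no RH
claims): by the explicit formula the windowed Weil form of a family with off-line zero quadruples
`½ ± δⱼ ± iγⱼ` is `B − 4 ∑ⱼ |dⱼ⟩⟨dⱼ|` with `B` the form of the remaining zeros and
`dⱼ = Im ∫ ξ e^{(δⱼ+iγⱼ)x}`; as long as `B ≥ 0` these lemmas say that the negative index of the
window equals the number of eigenvalues of the `m × m` capacitance matrix `4 Dᵀ B⁻¹ D` above `1`,
that every negative eigenvector is a combination of the resolvent-filtered profiles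
`(B + |ε|)⁻¹ dⱼ`, and that the moments solve the matrix secular equation. Abstract linear algebra
only; no definitions, no named facts; sorry-free.

## References
* E. V. Haynsworth, Determination of the inertia of a partitioned Hermitian matrix, Linear Algebra
  Appl. 1 (1968) 73–81, doi:10.1016/0024-3795(68)90050-5. [Haynsworth1968]
* D. S. Bernstein, *Matrix Mathematics*, 2nd ed., Princeton (2009), Fact 6.5.5 (Haynsworth inertia
  additivity formula), doi:10.1515/9781400833344. [Bernstein2009]
* G. H. Golub, C. F. Van Loan, *Matrix Computations*, 4th ed. (2013), §2.1.4 (Sherman–Morrison–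
  Woodbury), Thm 8.1.8, §8.4.3 Thm 8.4.3. [GolubVanLoan2013]
* P. Arbenz, G. H. Golub, On the spectral decomposition of Hermitian matrices modified by low rank
  perturbations with applications, SIAM J. Matrix Anal. Appl. 9 (1988) 40–58,
  doi:10.1137/0609004. [ArbenzGolub1988]
* J. R. Bunch, C. P. Nielsen, D. C. Sorensen, Rank-one modification of the symmetric eigenproblem,
  Numer. Math. 31 (1978) 31–48. [BunchNielsenSorensen1978]
-/

noncomputable section

open scoped InnerProductSpace RealInnerProductSpace BigOperators

namespace Literature.Analysis.InnerProduct

variable {E : Type*} [NormedAddCommGroup E] [InnerProductSpace ℝ E]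
variable {ι : Type*} [Fintype ι]

/-- **Negative index ≤ number of drivers** (existence form): if the form of `A` is nonnegative and
`W` is a subspace of dimension `> #ι`, some nonzero `x ∈ W` is annihilated by every driver, and there
`⟪A x, x⟫ − ∑ᵢ ⟪vᵢ, x⟫² = ⟪A x, x⟫ ≥ 0`. (The driver map `W → (ι → ℝ)` has a kernel by dimension
count.) [cite: GolubVanLoan2013, Thm 8.1.8; Haynsworth1968, inertia additivity formula] -/
theorem finiteRank_downdate_exists_nonneg (A : E →ₗ[ℝ] E) (hpos : ∀ x : E, 0 ≤ ⟪A x, x⟫_ℝ)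
    (v : ι → E) (W : Submodule ℝ E) (hW : Fintype.card ι < Module.finrank ℝ W) :
    ∃ x ∈ W, x ≠ 0 ∧ (∀ i, ⟪v i, x⟫_ℝ = 0) ∧
      0 ≤ ⟪A x, x⟫_ℝ - ∑ i, ⟪v i, x⟫_ℝ ^ 2 := by
  classical
  haveI : Module.Finite ℝ W := Module.finite_of_finrank_pos (lt_of_le_of_lt (Nat.zero_le _) hW)
  let S : W →ₗ[ℝ] (ι → ℝ) :=
    { toFun := fun w i => ⟪v i, (w : E)⟫_ℝ
      map_add' := fun w w' => funext fun i => by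
        simp only [Submodule.coe_add, inner_add_right, Pi.add_apply]
      map_smul' := fun r w => funext fun i => by
        simp only [Submodule.coe_smul, real_inner_smul_right, RingHom.id_apply, Pi.smul_apply,
          smul_eq_mul] }
  have hS : ∀ (w : W) (i : ι), S w i = ⟪v i, (w : E)⟫_ℝ := fun w i => rfl
  have hlt : Module.finrank ℝ (ι → ℝ) < Module.finrank ℝ W := by
    rw [Module.finrank_fintype_fun_eq_card]; exact hW
  have hker : LinearMap.ker S ≠ ⊥ := LinearMap.ker_ne_bot_of_finrank_lt hlt
  obtain ⟨w, hw, hw0⟩ := Submodule.exists_mem_ne_zero_of_ne_bot hker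
  have hwi : ∀ i, ⟪v i, (w : E)⟫_ℝ = 0 := fun i => by
    have h := congrFun (LinearMap.mem_ker.1 hw) i
    rw [hS] at h
    simpa using h
  refine ⟨(w : E), w.2, fun h => hw0 (Submodule.coe_eq_zero.1 h), hwi, ?_⟩
  have hsum : ∑ i, ⟪v i, (w : E)⟫_ℝ ^ 2 = 0 :=
    Finset.sum_eq_zero fun i _ => by rw [hwi i]; ring
  rw [hsum, sub_zero]
  exact hpos _

/-- **Negative index ≤ number of drivers** (dimension form): a subspace on which the downdated form
`⟪A x, x⟫ − ∑ᵢ ⟪vᵢ, x⟫²` is negative definite has dimension at most `#ι` (for an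
infinite-dimensional subspace `finrank = 0` and there is nothing to prove). No symmetry of `A` is
needed. [cite: GolubVanLoan2013, Thm 8.1.8; Haynsworth1968, inertia additivity formula] -/
theorem finiteRank_downdate_negSubspace_finrank_le (A : E →ₗ[ℝ] E)
    (hpos : ∀ x : E, 0 ≤ ⟪A x, x⟫_ℝ) (v : ι → E) (W : Submodule ℝ E)
    (hneg : ∀ x ∈ W, x ≠ 0 → ⟪A x, x⟫_ℝ - ∑ i, ⟪v i, x⟫_ℝ ^ 2 < 0) :
    Module.finrank ℝ W ≤ Fintype.card ι := by
  by_contra h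
  obtain ⟨x, hxW, hx0, -, hq⟩ :=
    finiteRank_downdate_exists_nonneg A hpos v W (not_le.mp h)
  exact absurd (hneg x hxW hx0) (not_lt.mpr hq)

/-- First comparison inequality (complete the square with `x − ∑ⱼ ⟪vⱼ, x⟫ zⱼ`): if `A` is symmetric
with nonnegative form and `A zᵢ = vᵢ`, then for every `x` the capacitance form at the moment vector
`cᵢ = ⟪vᵢ, x⟫` is at most the downdated form at `x`:
`∑ᵢ cᵢ² − ∑ᵢ∑ⱼ cᵢ cⱼ ⟪vᵢ, zⱼ⟫ ≤ ⟪A x, x⟫ − ∑ᵢ cᵢ²`. [cite: Bernstein2009, Fact 6.5.5; Haynsworth1968, inertia additivity formula] -/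
theorem finiteRank_downdate_capacitance_le (A : E →ₗ[ℝ] E)
    (hsym : ∀ x y : E, ⟪A x, y⟫_ℝ = ⟪x, A y⟫_ℝ) (hpos : ∀ x : E, 0 ≤ ⟪A x, x⟫_ℝ)
    (v z : ι → E) (hz : ∀ i, A (z i) = v i) (x : E) :
    (∑ i, ⟪v i, x⟫_ℝ ^ 2 - ∑ i, ∑ j, ⟪v i, x⟫_ℝ * ⟪v j, x⟫_ℝ * ⟪v i, z j⟫_ℝ) ≤
      ⟪A x, x⟫_ℝ - ∑ i, ⟪v i, x⟫_ℝ ^ 2 := by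
  classical
  set s : E := ∑ j, ⟪v j, x⟫_ℝ • z j with hs
  have hAs : A s = ∑ j, ⟪v j, x⟫_ℝ • v j := by
    rw [hs, map_sum]
    exact Finset.sum_congr rfl fun j _ => by rw [map_smul, hz j]
  have h1 : ⟪A s, x⟫_ℝ = ∑ j, ⟪v j, x⟫_ℝ ^ 2 := by
    rw [hAs, sum_inner]
    exact Finset.sum_congr rfl fun j _ => by rw [real_inner_smul_left]; ring
  have h2 : ⟪A s, s⟫_ℝ = ∑ i, ∑ j, ⟪v i, x⟫_ℝ * ⟪v j, x⟫_ℝ * ⟪v i, z j⟫_ℝ := by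
    rw [hAs, sum_inner]
    refine Finset.sum_congr rfl fun i _ => ?_
    rw [real_inner_smul_left, hs, inner_sum, Finset.mul_sum]
    exact Finset.sum_congr rfl fun j _ => by rw [real_inner_smul_right]; ring
  have h3 : ⟪A x, s⟫_ℝ = ⟪A s, x⟫_ℝ := (hsym x s).trans (real_inner_comm (A s) x)
  have h0 := hpos (x - s)
  rw [map_sub, inner_sub_left, inner_sub_right, inner_sub_right, h3, h1, h2] at h0
  linarith

/-- Second comparison inequality (no symmetry or positivity needed): with `A zᵢ = vᵢ`, for every
coefficient vector `c` the downdated form at `x = ∑ⱼ cⱼ zⱼ` is at most the capacitance form at `c`: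
`⟪A x, x⟫ − ∑ᵢ ⟪vᵢ, x⟫² ≤ ∑ᵢ cᵢ² − ∑ᵢ∑ⱼ cᵢ cⱼ ⟪vᵢ, zⱼ⟫` (the difference is `∑ᵢ (cᵢ − ⟪vᵢ, x⟫)²`).
[cite: Bernstein2009, Fact 6.5.5; Haynsworth1968, inertia additivity formula] -/
theorem finiteRank_downdate_le_capacitance (A : E →ₗ[ℝ] E) (v z : ι → E)
    (hz : ∀ i, A (z i) = v i) (c : ι → ℝ) :
    ⟪A (∑ j, c j • z j), ∑ j, c j • z j⟫_ℝ - ∑ i, ⟪v i, ∑ j, c j • z j⟫_ℝ ^ 2 ≤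
      ∑ i, c i ^ 2 - ∑ i, ∑ j, c i * c j * ⟪v i, z j⟫_ℝ := by
  classical
  set x : E := ∑ j, c j • z j with hx
  have hAx : A x = ∑ j, c j • v j := by
    rw [hx, map_sum]
    exact Finset.sum_congr rfl fun j _ => by rw [map_smul, hz j]
  have hmi : ∀ i, ⟪v i, x⟫_ℝ = ∑ j, c j * ⟪v i, z j⟫_ℝ := fun i => by
    rw [hx, inner_sum]
    exact Finset.sum_congr rfl fun j _ => by rw [real_inner_smul_right]
  have hAxx : ⟪A x, x⟫_ℝ = ∑ i, c i * ⟪v i, x⟫_ℝ := by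
    rw [hAx, sum_inner]
    exact Finset.sum_congr rfl fun j _ => by rw [real_inner_smul_left]
  have hB : ∑ i, ∑ j, c i * c j * ⟪v i, z j⟫_ℝ = ∑ i, c i * ⟪v i, x⟫_ℝ :=
    Finset.sum_congr rfl fun i _ => by
      rw [hmi i, Finset.mul_sum]
      exact Finset.sum_congr rfl fun j _ => by ring
  rw [hAxx, hB, ← Finset.sum_sub_distrib, ← Finset.sum_sub_distrib]
  exact Finset.sum_le_sum fun i _ => by nlinarith [sq_nonneg (c i - ⟪v i, x⟫_ℝ)]

/-- **Inertia transfer / multi-driver secular law** (Haynsworth inertia additivity for the bordered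
operator `[[A, V], [Vᵀ, I]]`, dimension-free): let `A` be symmetric with nonnegative form and
`A zᵢ = vᵢ` for every driver. Then for every `k`, the downdated form `⟪A x, x⟫ − ∑ᵢ ⟪vᵢ, x⟫²` is
negative definite on some `k`-dimensional subspace of `E` iff the capacitance form
`∑ᵢ cᵢ² − ∑ᵢ∑ⱼ cᵢ cⱼ ⟪vᵢ, zⱼ⟫` (matrix `I − Vᵀ A⁻¹ V`) is negative definite on some `k`-dimensional
subspace of `ι → ℝ`. Hence `n₋(A − V Vᵀ) = #{eigenvalues of Vᵀ A⁻¹ V above 1} ≤ #ι`, and for a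
single driver the downdate is indefinite iff `1 < ⟪v, z⟫` (`rankOne_downdate_indefinite_iff`).
[cite: Bernstein2009, Fact 6.5.5; Haynsworth1968, inertia additivity formula; ArbenzGolub1988, capacitance matrix] -/
theorem finiteRank_downdate_negSubspace_iff (A : E →ₗ[ℝ] E)
    (hsym : ∀ x y : E, ⟪A x, y⟫_ℝ = ⟪x, A y⟫_ℝ) (hpos : ∀ x : E, 0 ≤ ⟪A x, x⟫_ℝ)
    (v z : ι → E) (hz : ∀ i, A (z i) = v i) (k : ℕ) :
    (∃ W : Submodule ℝ E, Module.finrank ℝ W = k ∧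
        ∀ x ∈ W, x ≠ 0 → ⟪A x, x⟫_ℝ - ∑ i, ⟪v i, x⟫_ℝ ^ 2 < 0) ↔
    (∃ U : Submodule ℝ (ι → ℝ), Module.finrank ℝ U = k ∧
        ∀ c ∈ U, c ≠ 0 → (∑ i, c i ^ 2 - ∑ i, ∑ j, c i * c j * ⟪v i, z j⟫_ℝ) < 0) := by
  classical
  constructor
  · rintro ⟨W, hWk, hW⟩
    -- the driver (moment) map restricted to `W` is injective, and carries `W` to a `Cap`-negative subspace
    let S : W →ₗ[ℝ] (ι → ℝ) :=
      { toFun := fun w i => ⟪v i, (w : E)⟫_ℝ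
        map_add' := fun w w' => funext fun i => by
          simp only [Submodule.coe_add, inner_add_right, Pi.add_apply]
        map_smul' := fun r w => funext fun i => by
          simp only [Submodule.coe_smul, real_inner_smul_right, RingHom.id_apply, Pi.smul_apply,
            smul_eq_mul] }
    have hS : ∀ (w : W) (i : ι), S w i = ⟪v i, (w : E)⟫_ℝ := fun w i => rfl
    have hinj : Function.Injective S := by
      intro w w' h
      by_contra hne
      have hmem : (w : E) - w' ∈ W := W.sub_mem w.2 w'.2
      have hne' : (w : E) - w' ≠ 0 := fun h0 =>
        hne (Subtype.ext (sub_eq_zero.1 h0))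
      have hq := hW _ hmem hne'
      have hvi : ∀ i, ⟪v i, (w : E) - w'⟫_ℝ = 0 := fun i => by
        have hi := congrFun h i
        rw [hS, hS] at hi
        rw [inner_sub_right, hi, sub_self]
      have hsum : ∑ i, ⟪v i, (w : E) - w'⟫_ℝ ^ 2 = 0 :=
        Finset.sum_eq_zero fun i _ => by rw [hvi i]; ring
      have hp := hpos ((w : E) - w')
      rw [hsum, sub_zero] at hq
      exact absurd hq (not_lt.mpr hp)
    refine ⟨LinearMap.range S, by rw [LinearMap.finrank_range_of_inj hinj, hWk], ?_⟩
    rintro c hc hc0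
    obtain ⟨w, rfl⟩ := LinearMap.mem_range.1 hc
    have hw0 : (w : E) ≠ 0 := fun h0 => hc0 (by rw [Submodule.coe_eq_zero.1 h0, map_zero])
    have hq := hW _ w.2 hw0
    have hcap := finiteRank_downdate_capacitance_le A hsym hpos v z hz (w : E)
    have hSw : (fun i => S w i) = fun i => ⟪v i, (w : E)⟫_ℝ := funext fun i => hS w i
    show (∑ i, S w i ^ 2 - ∑ i, ∑ j, S w i * S w j * ⟪v i, z j⟫_ℝ) < 0
    simp only [hS]
    exact lt_of_le_of_lt hcap hq
  · rintro ⟨U, hUk, hU⟩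
    -- the combination map `c ↦ ∑ⱼ cⱼ zⱼ` restricted to `U` is injective, and carries `U` to a `q`-negative subspace
    let R : U →ₗ[ℝ] E :=
      { toFun := fun u => ∑ j, (u : ι → ℝ) j • z j
        map_add' := fun u u' => by
          simp only [Submodule.coe_add, Pi.add_apply, add_smul, Finset.sum_add_distrib]
        map_smul' := fun r u => by
          simp only [Submodule.coe_smul, Pi.smul_apply, smul_eq_mul, RingHom.id_apply,
            Finset.smul_sum, smul_smul] }
    have hR : ∀ u : U, R u = ∑ j, (u : ι → ℝ) j • z j := fun u => rfl
    have hinj : Function.Injective R := by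
      intro u u' h
      by_contra hne
      have hmem : (u : ι → ℝ) - u' ∈ U := U.sub_mem u.2 u'.2
      have hne' : (u : ι → ℝ) - u' ≠ 0 := fun h0 =>
        hne (Subtype.ext (sub_eq_zero.1 h0))
      have hcap := hU _ hmem hne'
      have hle := finiteRank_downdate_le_capacitance A v z hz ((u : ι → ℝ) - u')
      have hx0 : ∑ j, ((u : ι → ℝ) - u') j • z j = 0 := by
        have h' : R u - R u' = 0 := sub_eq_zero.2 h
        rw [hR, hR, ← Finset.sum_sub_distrib] at h'
        rw [← h']
        exact Finset.sum_congr rfl fun j _ => by rw [Pi.sub_apply, sub_smul]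
      rw [hx0, map_zero, inner_zero_left] at hle
      simp only [inner_zero_right, ne_eq, OfNat.ofNat_ne_zero, not_false_eq_true, zero_pow,
        Finset.sum_const_zero, sub_zero] at hle
      exact absurd hcap (not_lt.mpr hle)
    refine ⟨LinearMap.range R, by rw [LinearMap.finrank_range_of_inj hinj, hUk], ?_⟩
    rintro x hx hx0
    obtain ⟨u, rfl⟩ := LinearMap.mem_range.1 hx
    have hu0 : (u : ι → ℝ) ≠ 0 := fun h0 => hx0 (by rw [Submodule.coe_eq_zero.1 h0, map_zero])
    have hcap := hU _ u.2 hu0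
    have hle := finiteRank_downdate_le_capacitance A v z hz (u : ι → ℝ)
    rw [hR]
    exact lt_of_le_of_lt hle hcap

/-- **Multi-driver resolvent shadow**: if `A ≥ 0`, `ε > 0`, `A u − ∑ᵢ ⟪vᵢ, u⟫ vᵢ = −ε u` and
`A yᵢ + ε yᵢ = vᵢ` (`yᵢ = (A + ε)⁻¹ vᵢ`), then `u = ∑ᵢ ⟪vᵢ, u⟫ • yᵢ`: every negative eigenvector of
the downdate lies in the span of the resolvent-filtered drivers (the difference `w` satisfies
`A w = −ε w`, impossible for `w ≠ 0` when `A ≥ 0`).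
[cite: GolubVanLoan2013, Thm 8.4.3 (c); ArbenzGolub1988, block secular equation] -/
theorem finiteRank_downdate_eigenvector_eq_sum (A : E →ₗ[ℝ] E) (hpos : ∀ x : E, 0 ≤ ⟪A x, x⟫_ℝ)
    (v y : ι → E) {u : E} {ε : ℝ} (hε : 0 < ε)
    (hu : A u - ∑ i, ⟪v i, u⟫_ℝ • v i = -(ε • u)) (hy : ∀ i, A (y i) + ε • y i = v i) :
    u = ∑ i, ⟪v i, u⟫_ℝ • y i := by
  classical
  set w : E := u - ∑ i, ⟪v i, u⟫_ℝ • y i with hw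
  have hAu : A u = -(ε • u) + ∑ i, ⟪v i, u⟫_ℝ • v i := (sub_eq_iff_eq_add).mp hu
  have hAY : A (∑ i, ⟪v i, u⟫_ℝ • y i) =
      ∑ i, ⟪v i, u⟫_ℝ • v i - ε • ∑ i, ⟪v i, u⟫_ℝ • y i := by
    rw [map_sum, Finset.smul_sum, ← Finset.sum_sub_distrib]
    refine Finset.sum_congr rfl fun i _ => ?_
    rw [map_smul, eq_sub_of_add_eq (hy i), smul_sub, smul_comm]
  have hAw : A w = -(ε • w) := by
    rw [hw, map_sub, hAu, hAY, smul_sub]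
    abel
  have h1 := hpos w
  rw [hAw, inner_neg_left, real_inner_smul_left] at h1
  have h2 : ⟪w, w⟫_ℝ ≤ 0 := by nlinarith [real_inner_self_nonneg (x := w)]
  have hw0 : w = 0 := real_inner_self_nonpos.mp h2
  exact sub_eq_zero.mp hw0

/-- **Matrix secular equation at a negative eigenvalue**: in the situation of
`finiteRank_downdate_eigenvector_eq_sum` with `u ≠ 0`, the moment vector `cᵢ = ⟪vᵢ, u⟫` is NONZERO
and is fixed by the matrix `M(ε)ᵢⱼ = ⟪vᵢ, yⱼ⟫ = (Vᵀ (A + ε)⁻¹ V)ᵢⱼ`: `cᵢ = ∑ⱼ ⟪vᵢ, yⱼ⟫ cⱼ` for all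
`i`; in particular `1` is an eigenvalue of `Vᵀ (A + ε)⁻¹ V` (for one driver: `⟪v, y⟫ = 1`,
`rankOne_downdate_secular_eq_one`). [cite: GolubVanLoan2013, Thm 8.4.3 (a); ArbenzGolub1988, block secular equation] -/
theorem finiteRank_downdate_secular_system (A : E →ₗ[ℝ] E) (hpos : ∀ x : E, 0 ≤ ⟪A x, x⟫_ℝ)
    (v y : ι → E) {u : E} {ε : ℝ} (hε : 0 < ε) (hu0 : u ≠ 0)
    (hu : A u - ∑ i, ⟪v i, u⟫_ℝ • v i = -(ε • u)) (hy : ∀ i, A (y i) + ε • y i = v i) :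
    (fun i => ⟪v i, u⟫_ℝ) ≠ 0 ∧
      ∀ i, ⟪v i, u⟫_ℝ = ∑ j, ⟪v i, y j⟫_ℝ * ⟪v j, u⟫_ℝ := by
  classical
  have huy := finiteRank_downdate_eigenvector_eq_sum A hpos v y hε hu hy
  refine ⟨fun h0 => hu0 ?_, fun i => ?_⟩
  · rw [huy]
    exact Finset.sum_eq_zero fun i _ => by rw [show ⟪v i, u⟫_ℝ = 0 from congrFun h0 i, zero_smul]
  · conv_lhs => rw [huy]
    rw [inner_sum]
    exact Finset.sum_congr rfl fun j _ => by rw [real_inner_smul_right, mul_comm]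

/-- **Graded bound in the basis of `A`** (joint near-orthogonality of the drivers to the low rungs):
if the downdated form is bounded below by `−ε`, `∑ᵢ ⟪vᵢ, x⟫² ≤ ⟪A x, x⟫ + ε ⟪x, x⟫` for all `x`,
then every unit eigenvector `A φ = α φ` has `∑ᵢ ⟪vᵢ, φ⟫² ≤ α + ε`. [folklore] -/
theorem finiteRank_downdate_sum_sq_inner_le (A : E →ₗ[ℝ] E) (v : ι → E) {ε α : ℝ} {φ : E}
    (hbd : ∀ x : E, ∑ i, ⟪v i, x⟫_ℝ ^ 2 ≤ ⟪A x, x⟫_ℝ + ε * ⟪x, x⟫_ℝ)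
    (hφ : A φ = α • φ) (hφ1 : ‖φ‖ = 1) :
    ∑ i, ⟪v i, φ⟫_ℝ ^ 2 ≤ α + ε := by
  have h := hbd φ
  have hφφ : ⟪φ, φ⟫_ℝ = 1 := by rw [real_inner_self_eq_norm_sq, hφ1]; norm_num
  rw [hφ, real_inner_smul_left, hφφ] at h
  linarith

end Literature.Analysis.InnerProduct
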